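import Summits.QuantumFields.BalabanUV.Beta.GAN24.CombChargeAntisymPairForm
import Summits.QuantumFields.BalabanUV.Beta.GAN24.WilsonQuarticChargeWsym22

/-!
# `BalabanUV.Beta.GAN24.PairFormPeriodTowerBase` — binder row G-an2-4 ∕ (CONV-C), W-slot (α-0), ROW (C) AT LEVELS `≥ 1`, RULING R-gan24p1-g40-1's two-index tower:
# **THE BASE ROW `h0` AT EVERY FACE PERIOD — the level-`0` comb member read on period-`P` exit-face fields is `P²` times its period-`P` zero mode, a multiple of the Wilson
# tensor, hence an antisymmetric-PAIR FORM, with crossed value `16·M²·cE₂·c·P⁶` per ordered distinct pair** (generic colour constants, root, mixed table; `Tc = c • wsym22 M`,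
# ff-free border; `d = 3`) (G-an2-4 OWNER `b2b-balaban-gan24-p1`, gen 40; journal [GAN24P1-G40-INTENT2])

NOT IN PRINT; OUR BOOKKEEPING ([folklore] finite index algebra over two closed forms of the tree BY NAME — leaf-02 g62's `WilsonBiStencilCornerSupport.fourFace_memberZero_wsym22`
(`P⁴·fourFace_P = P^{4 − #{μ,ν,α,β}}·zmode_P`, every `P ≥ 1`) and leaf-02 g63's `WilsonQuarticChargeWsym22.zmode_memberZero_wsym22` (the Kronecker closed form at every period);
0 `def`, 0 cited fact, 0 `def … : Prop`, 0 sorry; one `decide` over `Fin 4⁴`).  HONEST FRAMING (cell contract, verbatim): «discharging `BetaPertH` makes Bałaban's UV stability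
UNCONDITIONAL — a real constructive-QFT result; it is NOT the continuum limit and NOT the Clay problem.»  HONEST DEPENDENCY (verbatim): «continuum YM on T⁴ ⇐ BetaPertH ∧ nine
spine estimates (0/9 proved); BetaPertH ⇐ (D1) ∧ (D4) ∧ CAP+tail; G-an2-4 gates asym, D1 and NE2/3/4.»

WHY.  RULING R-gan24p1-g40-1 (memo `HOME/b2b-balaban-gan24-p1/gen40/RULING-R-gan24p1-g40-1.md`; junction `PairFormPeriodTower.pairFormLS_tower₂`) proves road-P2's source pair
form `hSrc` ∕ (G14) by induction on the level with the FACE PERIOD generalised: the state at level `i` is the family of `LS`-ed reads of the level-`i` member on period-`P` exit-face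
fields, `P = Lc^m`.  Its BASE ROW `h0` asks, at EVERY period `P`, that the level-`0` member's face read be a pair form.  This file discharges `h0` in the face-read currency
`Z_P(0)(μν;αβ) := P⁴·Σ_{rr ∈ box P} Σ'_{u′} Σ'_x Σ'_z [(toSite rr)_μ, u′_ν, x_α, z_β ≡ −1 (mod P)]·T̃_0 μ (toSite rr) ν u′ x z (inl α) (inl β)` (= `zmode P (𝔇_P T̃_0)` by
`TableDressingZeroMode.zmode_tableDress_ff`; any other normalisation is a scalar multiple — `PairFormPeriodTower.exists_pairFormLS_smul`):
* §1 **`card_eq_two_or_wilsonSupport_trivial`** (`decide` on `Fin 4`): for every index pattern either `#{μ,ν,α,β} = 2` or the Wilson tensor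
  `2[μ=ν][α=β] − [μ=β][ν=α] − [μ=α][ν=β]` vanishes there (all three brackets false, or all true); **`faceWeight_mul_wilsonTensor_eq_pairForm`**: hence the face weight
  `P^{4 − #{μ,ν,α,β}}` acts on the Wilson tensor as `P²`, and `P^{4−#}·K·W = (P²K)·([μ=ν][α=β] − [μ=β][α=ν]) + (P²K)·([ν=μ][α=β] − [ν=β][α=μ])` — the ENTRYWISE pair form of
  `CombChargeAntisymPairForm.pairFormLS_of_pairForm`.
* §2 **`faceRead_memberZero_eq_pairForm`** (every entry of `Z_P(0)` in that shape, `K = cE₂·c·P⁴·(−4M²)`), **`pairFormLS_faceRead_memberZero`** (`∃ R` antisymmetric in each pair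
  with `LS(Z_P(0)) = R-form` — the `h0` row of `pairFormLS_tower₂` at every `P ≥ 1`), **`crossed_faceRead_memberZero`** (the crossed orbit sum `(a,b;a,b)`, `a ≠ b`, is
  `16·M²·cE₂·c·P⁶` — the base value `w_P` of the ledger `PairFormPeriodTower` §3).
* §3 the constant read (period index `0`): **`pairFormLS_zmode_memberZero`** (at ANY cell `N₀`, road-P2's plain cell charge of member `0` is a pair form — the `m = 0` base row;
  road-P2's `pairFormLS_member_one` is its pinned level-`1` instance), **`crossed_zmode_memberZero`** (its crossed value `16·M²·cE₂·c·N₀⁴`).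
Discharges NOTHING of (C)_{≥1} beyond this base row (the step displays at `(m, i)` are the suppliers'); asserts NO value of Bałaban's tables beyond the tree's level-0 closed
forms it composes by name; NEVER «G-an2-4 closed» as (CONV-C); NOT D1, NOT `BetaPertH`, NOT continuum, NOT Clay.  2026-08-24; no existing file touched.
-/

noncomputable section

open Finset
open scoped BigOperators
open Literature.MathematicalPhysics.QuantumFieldTheory
open Literature.MathematicalPhysics.QuantumFieldTheory.Balaban1983to89
open Literature.MathematicalPhysics.QuantumFieldTheory.Balaban1983to89.Beta
open OneStepResolventKernel (Fib)
open AffineAveraging (Site box toSite)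
open WilsonVertex2Sym (wsym22)
open Summit.QuantumFields.BalabanUV.Beta.SecondOrderUnits (unitS₂)
open Summit.QuantumFields.BalabanUV.Beta.SpineRooted (T2RecAt)
open Summit.QuantumFields.BalabanUV.Beta.GAN24.CombesThomas (sfStep smStep)
open Summit.QuantumFields.BalabanUV.Beta.GAN24.BiStencilZeroMode (Tab zmode)
open Summit.QuantumFields.BalabanUV.Beta.GAN24.WilsonBiStencilCornerSupport (fourFace_memberZero_wsym22)
open Summit.QuantumFields.BalabanUV.Beta.GAN24.WilsonQuarticChargeWsym22 (zmode_memberZero_wsym22)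
open Summit.QuantumFields.BalabanUV.Beta.GAN24.CombChargeAntisymPairForm (pairFormLS_of_pairForm pairFormLS_antisym_fst pairFormLS_antisym_snd)

namespace Summit.QuantumFields.BalabanUV.Beta.GAN24.PairFormPeriodTowerBase

/-! ## §1 The face weight on the support of the Wilson tensor -/

/-- [folklore] On `Fin 4`: for every index pattern, either exactly two distinct indices occur, or the Wilson tensor `2[μ=ν][α=β] − [μ=β][ν=α] − [μ=α][ν=β]` vanishes there
(its three brackets all false, or all true — the all-equal pattern).  A finite check (`decide`, `4⁴` patterns). -/
theorem card_eq_two_or_wilsonSupport_trivial : ∀ μ ν α β : Fin 4,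
    ({μ, ν, α, β} : Finset (Fin 4)).card = 2 ∨
      ((¬(μ = ν ∧ α = β) ∧ ¬(μ = β ∧ ν = α) ∧ ¬(μ = α ∧ ν = β)) ∨ ((μ = ν ∧ α = β) ∧ (μ = β ∧ ν = α) ∧ (μ = α ∧ ν = β))) := by
  decide

/-- NOT IN PRINT; OUR BOOKKEEPING.  **THE FACE WEIGHT ACTS AS `P²` ON THE WILSON TENSOR, WHICH IS AN ENTRYWISE PAIR FORM**:
`P^{4 − #{μ,ν,α,β}}·(K·(2[μ=ν][α=β] − [μ=β][ν=α] − [μ=α][ν=β])) = (P²K)·([μ=ν][α=β] − [μ=β][α=ν]) + (P²K)·([ν=μ][α=β] − [ν=β][α=μ])` — the shape `A(μν;αβ) = Q(μα;νβ) + Q(να;μβ)`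
of `CombChargeAntisymPairForm.pairFormLS_of_pairForm` with `Q(a,b;c,e) := (P²K)·([a=c][b=e] − [a=e][b=c])`. -/
theorem faceWeight_mul_wilsonTensor_eq_pairForm (P : ℕ) (K : ℝ) (μ ν α β : Fin 4) :
    (P : ℝ) ^ (4 - ({μ, ν, α, β} : Finset (Fin 4)).card) *
        (K * ((if μ = ν ∧ α = β then (2 : ℝ) else 0) - (if μ = β ∧ ν = α then (1 : ℝ) else 0) - (if μ = α ∧ ν = β then (1 : ℝ) else 0)))
      = (P : ℝ) ^ 2 * K * ((if μ = ν ∧ α = β then (1 : ℝ) else 0) - (if μ = β ∧ α = ν then (1 : ℝ) else 0))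
        + (P : ℝ) ^ 2 * K * ((if ν = μ ∧ α = β then (1 : ℝ) else 0) - (if ν = β ∧ α = μ then (1 : ℝ) else 0)) := by
  have e1 : (ν = μ ∧ α = β) ↔ (μ = ν ∧ α = β) := ⟨fun h => ⟨h.1.symm, h.2⟩, fun h => ⟨h.1.symm, h.2⟩⟩
  have e2 : (μ = β ∧ α = ν) ↔ (μ = β ∧ ν = α) := ⟨fun h => ⟨h.1, h.2.symm⟩, fun h => ⟨h.1, h.2.symm⟩⟩
  have e3 : (ν = β ∧ α = μ) ↔ (μ = α ∧ ν = β) := ⟨fun h => ⟨h.2.symm, h.1⟩, fun h => ⟨h.2, h.1.symm⟩⟩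
  simp only [e1, e2, e3]
  rcases card_eq_two_or_wilsonSupport_trivial μ ν α β with h2 | ⟨hA, hB, hC⟩ | ⟨hA, hB, hC⟩
  · rw [h2, show (4 : ℕ) - 2 = 2 from rfl]
    split_ifs <;> ring
  · simp only [if_neg hA, if_neg hB, if_neg hC]; ring
  · simp only [if_pos hA, if_pos hB, if_pos hC]; ring

/-- [folklore] The pair function `Q(a,b;c,e) := K′·([a=c][b=e] − [a=e][b=c])` is antisymmetric in its first pair. -/
theorem kroneckerPair_antisym_fst (K' : ℝ) (a b c e : Fin 4) :
    K' * ((if b = c ∧ a = e then (1 : ℝ) else 0) - (if b = e ∧ a = c then (1 : ℝ) else 0))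
      = -(K' * ((if a = c ∧ b = e then (1 : ℝ) else 0) - (if a = e ∧ b = c then (1 : ℝ) else 0))) := by
  have e1 : (b = c ∧ a = e) ↔ (a = e ∧ b = c) := and_comm
  have e2 : (b = e ∧ a = c) ↔ (a = c ∧ b = e) := and_comm
  simp only [e1, e2]; ring

/-- [folklore] The pair function `Q(a,b;c,e) := K′·([a=c][b=e] − [a=e][b=c])` is antisymmetric in its second pair. -/
theorem kroneckerPair_antisym_snd (K' : ℝ) (a b c e : Fin 4) :
    K' * ((if a = e ∧ b = c then (1 : ℝ) else 0) - (if a = c ∧ b = e then (1 : ℝ) else 0))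
      = -(K' * ((if a = c ∧ b = e then (1 : ℝ) else 0) - (if a = e ∧ b = c then (1 : ℝ) else 0))) := by
  ring

/-! ## §2 The level-0 member's face read at every period: entrywise pair form, `LS` pair form, crossed value -/

section MemberZero

variable {Lc : ℕ} [NeZero Lc]

/-- NOT IN PRINT; OUR BOOKKEEPING.  **EVERY ENTRY OF THE PERIOD-`P` FACE READ OF MEMBER `0` IS THE ENTRYWISE PAIR FORM** with `Q(a,b;c,e) = (P²K)·([a=c][b=e] − [a=e][b=c])`,
`K = cE₂·c·P⁴·(−4M²)`: `fourFace_memberZero_wsym22` (the face weight `P^{4−#}` against the period-`P` zero mode) ⨾ `zmode_memberZero_wsym22` (the Kronecker closed form at period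
`P`) ⨾ §1.  Generic colour constants `cE cVH cΛ cE₂ cB`, group size `M`, normalisation `c`, root `ρ`, mixed table; ff-free border `hBff` (the literal's `vh₂SAn1`). -/
theorem faceRead_memberZero_eq_pairForm {P : ℕ} (hP : 1 ≤ P) (cE cVH cΛ cE₂ cB c : ℝ) (M : ℕ) (ρ : Fin (3 + 1) → ℤ) {vh₂S mixFF : Tab 3}
    (hBff : ∀ κ u κ' u' x z (α β : Fin (3 + 1)), vh₂S κ u κ' u' x z (Sum.inl α) (Sum.inl β) = 0) (μ ν α β : Fin (3 + 1)) :
    (P : ℝ) ^ 4 * ∑ rr ∈ box (3 + 1) P, ∑' u' : Site (3 + 1), ∑' x : Site (3 + 1), ∑' z : Site (3 + 1),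
        (if toSite rr μ % (P : ℤ) = (P : ℤ) - 1 ∧ u' ν % (P : ℤ) = (P : ℤ) - 1 ∧ x α % (P : ℤ) = (P : ℤ) - 1 ∧ z β % (P : ℤ) = (P : ℤ) - 1
          then unitS₂ (sfStep Lc 0) (smStep 3 Lc 0) (T2RecAt 3 Lc ρ cE cVH cΛ cE₂ cB (c • wsym22 M) vh₂S mixFF 0) μ (toSite rr) ν u' x z (Sum.inl α) (Sum.inl β)
          else 0)
      = (P : ℝ) ^ 2 * (cE₂ * c * (P : ℝ) ^ (3 + 1) * (-4 * (M : ℝ) ^ 2)) * ((if μ = ν ∧ α = β then (1 : ℝ) else 0) - (if μ = β ∧ α = ν then (1 : ℝ) else 0))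
        + (P : ℝ) ^ 2 * (cE₂ * c * (P : ℝ) ^ (3 + 1) * (-4 * (M : ℝ) ^ 2)) * ((if ν = μ ∧ α = β then (1 : ℝ) else 0) - (if ν = β ∧ α = μ then (1 : ℝ) else 0)) := by
  have hK : cE₂ * c * ((P : ℝ) ^ (3 + 1) * (-4 * (M : ℝ) ^ 2 *
      ((if μ = ν ∧ α = β then (2 : ℝ) else 0) - (if μ = β ∧ ν = α then (1 : ℝ) else 0) - (if μ = α ∧ ν = β then (1 : ℝ) else 0))))
      = (cE₂ * c * (P : ℝ) ^ (3 + 1) * (-4 * (M : ℝ) ^ 2)) *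
        ((if μ = ν ∧ α = β then (2 : ℝ) else 0) - (if μ = β ∧ ν = α then (1 : ℝ) else 0) - (if μ = α ∧ ν = β then (1 : ℝ) else 0)) := by ring
  rw [fourFace_memberZero_wsym22 (d := 3) hP cE cVH cΛ cE₂ cB c M ρ hBff μ ν α β, zmode_memberZero_wsym22 (d := 3) P cE cVH cΛ cE₂ cB c M ρ hBff μ ν α β, hK,
    faceWeight_mul_wilsonTensor_eq_pairForm]

/-- NOT IN PRINT; OUR BOOKKEEPING.  **THE BASE ROW `h0` OF THE TWO-INDEX TOWER AT EVERY PERIOD**: for every `P ≥ 1` the leg-and-bond symmetrisation `LS` of the period-`P`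
face read `Z_P(0)` of the level-0 member is an antisymmetric-pair form (`PairFormPeriodTower.pairFormLS_tower₂`'s `h0` at the period index of `P`; F9's spelling VERBATIM). -/
theorem pairFormLS_faceRead_memberZero {P : ℕ} (hP : 1 ≤ P) (cE cVH cΛ cE₂ cB c : ℝ) (M : ℕ) (ρ : Fin (3 + 1) → ℤ) {vh₂S mixFF : Tab 3}
    (hBff : ∀ κ u κ' u' x z (α β : Fin (3 + 1)), vh₂S κ u κ' u' x z (Sum.inl α) (Sum.inl β) = 0) :
    ∃ R : Fin (3 + 1) → Fin (3 + 1) → Fin (3 + 1) → Fin (3 + 1) → ℝ,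
      (∀ a b c e, R b a c e = -R a b c e) ∧ (∀ a b c e, R a b e c = -R a b c e) ∧
      ∀ κ κ' κ₁ κ₂ : Fin (3 + 1),
        (P : ℝ) ^ 4 * (∑ rr ∈ box (3 + 1) P, ∑' u' : Site (3 + 1), ∑' x : Site (3 + 1), ∑' z : Site (3 + 1),
            (if toSite rr κ % (P : ℤ) = (P : ℤ) - 1 ∧ u' κ' % (P : ℤ) = (P : ℤ) - 1 ∧ x κ₁ % (P : ℤ) = (P : ℤ) - 1 ∧ z κ₂ % (P : ℤ) = (P : ℤ) - 1
              then unitS₂ (sfStep Lc 0) (smStep 3 Lc 0) (T2RecAt 3 Lc ρ cE cVH cΛ cE₂ cB (c • wsym22 M) vh₂S mixFF 0) κ (toSite rr) κ' u' x z (Sum.inl κ₁) (Sum.inl κ₂) else 0))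
        + (P : ℝ) ^ 4 * (∑ rr ∈ box (3 + 1) P, ∑' u' : Site (3 + 1), ∑' x : Site (3 + 1), ∑' z : Site (3 + 1),
            (if toSite rr κ' % (P : ℤ) = (P : ℤ) - 1 ∧ u' κ % (P : ℤ) = (P : ℤ) - 1 ∧ x κ₁ % (P : ℤ) = (P : ℤ) - 1 ∧ z κ₂ % (P : ℤ) = (P : ℤ) - 1
              then unitS₂ (sfStep Lc 0) (smStep 3 Lc 0) (T2RecAt 3 Lc ρ cE cVH cΛ cE₂ cB (c • wsym22 M) vh₂S mixFF 0) κ' (toSite rr) κ u' x z (Sum.inl κ₁) (Sum.inl κ₂) else 0))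
        + ((P : ℝ) ^ 4 * (∑ rr ∈ box (3 + 1) P, ∑' u' : Site (3 + 1), ∑' x : Site (3 + 1), ∑' z : Site (3 + 1),
            (if toSite rr κ % (P : ℤ) = (P : ℤ) - 1 ∧ u' κ' % (P : ℤ) = (P : ℤ) - 1 ∧ x κ₂ % (P : ℤ) = (P : ℤ) - 1 ∧ z κ₁ % (P : ℤ) = (P : ℤ) - 1
              then unitS₂ (sfStep Lc 0) (smStep 3 Lc 0) (T2RecAt 3 Lc ρ cE cVH cΛ cE₂ cB (c • wsym22 M) vh₂S mixFF 0) κ (toSite rr) κ' u' x z (Sum.inl κ₂) (Sum.inl κ₁) else 0))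
          + (P : ℝ) ^ 4 * (∑ rr ∈ box (3 + 1) P, ∑' u' : Site (3 + 1), ∑' x : Site (3 + 1), ∑' z : Site (3 + 1),
            (if toSite rr κ' % (P : ℤ) = (P : ℤ) - 1 ∧ u' κ % (P : ℤ) = (P : ℤ) - 1 ∧ x κ₂ % (P : ℤ) = (P : ℤ) - 1 ∧ z κ₁ % (P : ℤ) = (P : ℤ) - 1
              then unitS₂ (sfStep Lc 0) (smStep 3 Lc 0) (T2RecAt 3 Lc ρ cE cVH cΛ cE₂ cB (c • wsym22 M) vh₂S mixFF 0) κ' (toSite rr) κ u' x z (Sum.inl κ₂) (Sum.inl κ₁) else 0)))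
        = R κ κ₁ κ' κ₂ + R κ' κ₁ κ κ₂ + (R κ κ₂ κ' κ₁ + R κ' κ₂ κ κ₁) := by
  -- the pair function `Q(i,j;k,l) := (P²K)·([i=k][j=l] − [i=l][j=k])`, `K = cE₂·c·P⁴·(−4M²)`; `R := 2Q`
  have hQ1 : ∀ i j k l : Fin (3 + 1), (P : ℝ) ^ 2 * (cE₂ * c * (P : ℝ) ^ (3 + 1) * (-4 * (M : ℝ) ^ 2)) *
        ((if j = k ∧ i = l then (1 : ℝ) else 0) - (if j = l ∧ i = k then (1 : ℝ) else 0))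
      = -((P : ℝ) ^ 2 * (cE₂ * c * (P : ℝ) ^ (3 + 1) * (-4 * (M : ℝ) ^ 2)) *
        ((if i = k ∧ j = l then (1 : ℝ) else 0) - (if i = l ∧ j = k then (1 : ℝ) else 0))) :=
    fun i j k l => kroneckerPair_antisym_fst ((P : ℝ) ^ 2 * (cE₂ * c * (P : ℝ) ^ (3 + 1) * (-4 * (M : ℝ) ^ 2))) i j k l
  have hQ2 : ∀ i j k l : Fin (3 + 1), (P : ℝ) ^ 2 * (cE₂ * c * (P : ℝ) ^ (3 + 1) * (-4 * (M : ℝ) ^ 2)) *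
        ((if i = l ∧ j = k then (1 : ℝ) else 0) - (if i = k ∧ j = l then (1 : ℝ) else 0))
      = -((P : ℝ) ^ 2 * (cE₂ * c * (P : ℝ) ^ (3 + 1) * (-4 * (M : ℝ) ^ 2)) *
        ((if i = k ∧ j = l then (1 : ℝ) else 0) - (if i = l ∧ j = k then (1 : ℝ) else 0))) :=
    fun i j k l => kroneckerPair_antisym_snd ((P : ℝ) ^ 2 * (cE₂ * c * (P : ℝ) ^ (3 + 1) * (-4 * (M : ℝ) ^ 2))) i j k l
  refine ⟨fun i j k l => 2 * ((P : ℝ) ^ 2 * (cE₂ * c * (P : ℝ) ^ (3 + 1) * (-4 * (M : ℝ) ^ 2)) *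
      ((if i = k ∧ j = l then (1 : ℝ) else 0) - (if i = l ∧ j = k then (1 : ℝ) else 0))), ?_, ?_, fun κ κ' κ₁ κ₂ => ?_⟩
  · intro i j k l
    exact pairFormLS_antisym_fst (P := fun i j k l => (P : ℝ) ^ 2 * (cE₂ * c * (P : ℝ) ^ (3 + 1) * (-4 * (M : ℝ) ^ 2)) *
        ((if i = k ∧ j = l then (1 : ℝ) else 0) - (if i = l ∧ j = k then (1 : ℝ) else 0))) hQ1 i j k l
  · intro i j k l
    exact pairFormLS_antisym_snd (P := fun i j k l => (P : ℝ) ^ 2 * (cE₂ * c * (P : ℝ) ^ (3 + 1) * (-4 * (M : ℝ) ^ 2)) *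
        ((if i = k ∧ j = l then (1 : ℝ) else 0) - (if i = l ∧ j = k then (1 : ℝ) else 0))) hQ2 i j k l
  · exact pairFormLS_of_pairForm
      (A := fun μ ν α β => (P : ℝ) ^ 4 * ∑ rr ∈ box (3 + 1) P, ∑' u' : Site (3 + 1), ∑' x : Site (3 + 1), ∑' z : Site (3 + 1),
        (if toSite rr μ % (P : ℤ) = (P : ℤ) - 1 ∧ u' ν % (P : ℤ) = (P : ℤ) - 1 ∧ x α % (P : ℤ) = (P : ℤ) - 1 ∧ z β % (P : ℤ) = (P : ℤ) - 1
          then unitS₂ (sfStep Lc 0) (smStep 3 Lc 0) (T2RecAt 3 Lc ρ cE cVH cΛ cE₂ cB (c • wsym22 M) vh₂S mixFF 0) μ (toSite rr) ν u' x z (Sum.inl α) (Sum.inl β) else 0))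
      (P := fun i j k l => (P : ℝ) ^ 2 * (cE₂ * c * (P : ℝ) ^ (3 + 1) * (-4 * (M : ℝ) ^ 2)) *
        ((if i = k ∧ j = l then (1 : ℝ) else 0) - (if i = l ∧ j = k then (1 : ℝ) else 0)))
      (fun μ ν α β => faceRead_memberZero_eq_pairForm hP cE cVH cΛ cE₂ cB c M ρ hBff μ ν α β) κ κ' κ₁ κ₂

/-- NOT IN PRINT; OUR BOOKKEEPING.  **THE BASE VALUE OF THE LEDGER**: for an ordered distinct pair `a ≠ b`, the crossed orbit sum `(a,b;a,b)` of the period-`P` face read of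
member `0` is `16·M²·cE₂·c·P⁶` (each of the four crossed entries is `−P²K`, `K = cE₂·c·P⁴·(−4M²)`) — the `w_P` of `PairFormPeriodTower` §3; at the literal's pins
(`c = (8N²)⁻¹`, `M = N`, `cE₂ = Lc⁸`) this is `2·Lc⁸·P⁶`. -/
theorem crossed_faceRead_memberZero {P : ℕ} (hP : 1 ≤ P) (cE cVH cΛ cE₂ cB c : ℝ) (M : ℕ) (ρ : Fin (3 + 1) → ℤ) {vh₂S mixFF : Tab 3}
    (hBff : ∀ κ u κ' u' x z (α β : Fin (3 + 1)), vh₂S κ u κ' u' x z (Sum.inl α) (Sum.inl β) = 0) {a b : Fin (3 + 1)} (hab : a ≠ b) :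
    (P : ℝ) ^ 4 * (∑ rr ∈ box (3 + 1) P, ∑' u' : Site (3 + 1), ∑' x : Site (3 + 1), ∑' z : Site (3 + 1),
        (if toSite rr a % (P : ℤ) = (P : ℤ) - 1 ∧ u' b % (P : ℤ) = (P : ℤ) - 1 ∧ x a % (P : ℤ) = (P : ℤ) - 1 ∧ z b % (P : ℤ) = (P : ℤ) - 1
          then unitS₂ (sfStep Lc 0) (smStep 3 Lc 0) (T2RecAt 3 Lc ρ cE cVH cΛ cE₂ cB (c • wsym22 M) vh₂S mixFF 0) a (toSite rr) b u' x z (Sum.inl a) (Sum.inl b) else 0))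
    + (P : ℝ) ^ 4 * (∑ rr ∈ box (3 + 1) P, ∑' u' : Site (3 + 1), ∑' x : Site (3 + 1), ∑' z : Site (3 + 1),
        (if toSite rr b % (P : ℤ) = (P : ℤ) - 1 ∧ u' a % (P : ℤ) = (P : ℤ) - 1 ∧ x a % (P : ℤ) = (P : ℤ) - 1 ∧ z b % (P : ℤ) = (P : ℤ) - 1
          then unitS₂ (sfStep Lc 0) (smStep 3 Lc 0) (T2RecAt 3 Lc ρ cE cVH cΛ cE₂ cB (c • wsym22 M) vh₂S mixFF 0) b (toSite rr) a u' x z (Sum.inl a) (Sum.inl b) else 0))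
    + ((P : ℝ) ^ 4 * (∑ rr ∈ box (3 + 1) P, ∑' u' : Site (3 + 1), ∑' x : Site (3 + 1), ∑' z : Site (3 + 1),
        (if toSite rr a % (P : ℤ) = (P : ℤ) - 1 ∧ u' b % (P : ℤ) = (P : ℤ) - 1 ∧ x b % (P : ℤ) = (P : ℤ) - 1 ∧ z a % (P : ℤ) = (P : ℤ) - 1
          then unitS₂ (sfStep Lc 0) (smStep 3 Lc 0) (T2RecAt 3 Lc ρ cE cVH cΛ cE₂ cB (c • wsym22 M) vh₂S mixFF 0) a (toSite rr) b u' x z (Sum.inl b) (Sum.inl a) else 0))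
      + (P : ℝ) ^ 4 * (∑ rr ∈ box (3 + 1) P, ∑' u' : Site (3 + 1), ∑' x : Site (3 + 1), ∑' z : Site (3 + 1),
        (if toSite rr b % (P : ℤ) = (P : ℤ) - 1 ∧ u' a % (P : ℤ) = (P : ℤ) - 1 ∧ x b % (P : ℤ) = (P : ℤ) - 1 ∧ z a % (P : ℤ) = (P : ℤ) - 1
          then unitS₂ (sfStep Lc 0) (smStep 3 Lc 0) (T2RecAt 3 Lc ρ cE cVH cΛ cE₂ cB (c • wsym22 M) vh₂S mixFF 0) b (toSite rr) a u' x z (Sum.inl b) (Sum.inl a) else 0)))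
      = 16 * (M : ℝ) ^ 2 * cE₂ * c * (P : ℝ) ^ 6 := by
  have hba : b ≠ a := fun h => hab h.symm
  rw [faceRead_memberZero_eq_pairForm hP cE cVH cΛ cE₂ cB c M ρ hBff a b a b, faceRead_memberZero_eq_pairForm hP cE cVH cΛ cE₂ cB c M ρ hBff b a a b,
    faceRead_memberZero_eq_pairForm hP cE cVH cΛ cE₂ cB c M ρ hBff a b b a, faceRead_memberZero_eq_pairForm hP cE cVH cΛ cE₂ cB c M ρ hBff b a b a]
  simp only [hab, hba, and_self, if_true, if_false]
  ring

/-! ## §3 The constant read (period index `0`): the plain cell charge of member `0` at any cell, pair form and crossed value -/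

/-- NOT IN PRINT; OUR BOOKKEEPING.  **THE `m = 0` BASE ROW**: at ANY cell `N₀` the leg-and-bond symmetrisation of road-P2's plain zero-mode charge `zmode N₀ T̃_0 κ κ′ (inl κ₁) (inl κ₂)`
of the level-0 member is an antisymmetric-pair form (entries `K₀·(Wilson tensor)`, `K₀ = cE₂·c·N₀⁴·(−4M²)`, by `zmode_memberZero_wsym22`; generic constants ∕ root ∕ mixed table,
ff-free border) — the constant-field row of `pairFormLS_tower₂`'s `h0` (road-P2's `pairFormLS_member_one` is the pinned level-`1` instance of the same closed form). -/
theorem pairFormLS_zmode_memberZero (N₀ : ℕ) (cE cVH cΛ cE₂ cB c : ℝ) (M : ℕ) (ρ : Fin (3 + 1) → ℤ) {vh₂S mixFF : Tab 3}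
    (hBff : ∀ κ u κ' u' x z (α β : Fin (3 + 1)), vh₂S κ u κ' u' x z (Sum.inl α) (Sum.inl β) = 0) :
    ∃ R : Fin (3 + 1) → Fin (3 + 1) → Fin (3 + 1) → Fin (3 + 1) → ℝ,
      (∀ a b c e, R b a c e = -R a b c e) ∧ (∀ a b c e, R a b e c = -R a b c e) ∧
      ∀ κ κ' κ₁ κ₂ : Fin (3 + 1),
        zmode N₀ (unitS₂ (sfStep Lc 0) (smStep 3 Lc 0) (T2RecAt 3 Lc ρ cE cVH cΛ cE₂ cB (c • wsym22 M) vh₂S mixFF 0)) κ κ' (Sum.inl κ₁) (Sum.inl κ₂)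
          + zmode N₀ (unitS₂ (sfStep Lc 0) (smStep 3 Lc 0) (T2RecAt 3 Lc ρ cE cVH cΛ cE₂ cB (c • wsym22 M) vh₂S mixFF 0)) κ' κ (Sum.inl κ₁) (Sum.inl κ₂)
          + (zmode N₀ (unitS₂ (sfStep Lc 0) (smStep 3 Lc 0) (T2RecAt 3 Lc ρ cE cVH cΛ cE₂ cB (c • wsym22 M) vh₂S mixFF 0)) κ κ' (Sum.inl κ₂) (Sum.inl κ₁)
          + zmode N₀ (unitS₂ (sfStep Lc 0) (smStep 3 Lc 0) (T2RecAt 3 Lc ρ cE cVH cΛ cE₂ cB (c • wsym22 M) vh₂S mixFF 0)) κ' κ (Sum.inl κ₂) (Sum.inl κ₁))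
        = R κ κ₁ κ' κ₂ + R κ' κ₁ κ κ₂ + (R κ κ₂ κ' κ₁ + R κ' κ₂ κ κ₁) := by
  -- the entrywise pair form of the Wilson tensor (finite index algebra)
  have hW : ∀ μ ν α β : Fin (3 + 1),
      cE₂ * c * ((N₀ : ℝ) ^ (3 + 1) * (-4 * (M : ℝ) ^ 2 *
        ((if μ = ν ∧ α = β then (2 : ℝ) else 0) - (if μ = β ∧ ν = α then (1 : ℝ) else 0) - (if μ = α ∧ ν = β then (1 : ℝ) else 0))))
      = (cE₂ * c * (N₀ : ℝ) ^ (3 + 1) * (-4 * (M : ℝ) ^ 2)) * ((if μ = ν ∧ α = β then (1 : ℝ) else 0) - (if μ = β ∧ α = ν then (1 : ℝ) else 0))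
        + (cE₂ * c * (N₀ : ℝ) ^ (3 + 1) * (-4 * (M : ℝ) ^ 2)) * ((if ν = μ ∧ α = β then (1 : ℝ) else 0) - (if ν = β ∧ α = μ then (1 : ℝ) else 0)) := by
    intro μ ν α β
    have e1 : (ν = μ ∧ α = β) ↔ (μ = ν ∧ α = β) := ⟨fun h => ⟨h.1.symm, h.2⟩, fun h => ⟨h.1.symm, h.2⟩⟩
    have e2 : (μ = β ∧ α = ν) ↔ (μ = β ∧ ν = α) := ⟨fun h => ⟨h.1, h.2.symm⟩, fun h => ⟨h.1, h.2.symm⟩⟩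
    have e3 : (ν = β ∧ α = μ) ↔ (μ = α ∧ ν = β) := ⟨fun h => ⟨h.2.symm, h.1⟩, fun h => ⟨h.2, h.1.symm⟩⟩
    simp only [e1, e2, e3]
    split_ifs <;> ring
  have hent : ∀ μ ν α β : Fin (3 + 1),
      zmode N₀ (unitS₂ (sfStep Lc 0) (smStep 3 Lc 0) (T2RecAt 3 Lc ρ cE cVH cΛ cE₂ cB (c • wsym22 M) vh₂S mixFF 0)) μ ν (Sum.inl α) (Sum.inl β)
      = (cE₂ * c * (N₀ : ℝ) ^ (3 + 1) * (-4 * (M : ℝ) ^ 2)) * ((if μ = ν ∧ α = β then (1 : ℝ) else 0) - (if μ = β ∧ α = ν then (1 : ℝ) else 0))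
        + (cE₂ * c * (N₀ : ℝ) ^ (3 + 1) * (-4 * (M : ℝ) ^ 2)) * ((if ν = μ ∧ α = β then (1 : ℝ) else 0) - (if ν = β ∧ α = μ then (1 : ℝ) else 0)) := by
    intro μ ν α β
    rw [zmode_memberZero_wsym22 (d := 3) N₀ cE cVH cΛ cE₂ cB c M ρ hBff μ ν α β, hW]
  refine ⟨fun i j k l => 2 * ((cE₂ * c * (N₀ : ℝ) ^ (3 + 1) * (-4 * (M : ℝ) ^ 2)) *
      ((if i = k ∧ j = l then (1 : ℝ) else 0) - (if i = l ∧ j = k then (1 : ℝ) else 0))), ?_, ?_, fun κ κ' κ₁ κ₂ => ?_⟩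
  · intro i j k l
    exact pairFormLS_antisym_fst (P := fun i j k l => (cE₂ * c * (N₀ : ℝ) ^ (3 + 1) * (-4 * (M : ℝ) ^ 2)) *
        ((if i = k ∧ j = l then (1 : ℝ) else 0) - (if i = l ∧ j = k then (1 : ℝ) else 0)))
      (fun i j k l => kroneckerPair_antisym_fst (cE₂ * c * (N₀ : ℝ) ^ (3 + 1) * (-4 * (M : ℝ) ^ 2)) i j k l) i j k l
  · intro i j k l
    exact pairFormLS_antisym_snd (P := fun i j k l => (cE₂ * c * (N₀ : ℝ) ^ (3 + 1) * (-4 * (M : ℝ) ^ 2)) *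
        ((if i = k ∧ j = l then (1 : ℝ) else 0) - (if i = l ∧ j = k then (1 : ℝ) else 0)))
      (fun i j k l => kroneckerPair_antisym_snd (cE₂ * c * (N₀ : ℝ) ^ (3 + 1) * (-4 * (M : ℝ) ^ 2)) i j k l) i j k l
  · exact pairFormLS_of_pairForm
      (A := fun μ ν α β => zmode N₀ (unitS₂ (sfStep Lc 0) (smStep 3 Lc 0) (T2RecAt 3 Lc ρ cE cVH cΛ cE₂ cB (c • wsym22 M) vh₂S mixFF 0)) μ ν (Sum.inl α) (Sum.inl β))
      (P := fun i j k l => (cE₂ * c * (N₀ : ℝ) ^ (3 + 1) * (-4 * (M : ℝ) ^ 2)) *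
        ((if i = k ∧ j = l then (1 : ℝ) else 0) - (if i = l ∧ j = k then (1 : ℝ) else 0))) hent κ κ' κ₁ κ₂

/-- NOT IN PRINT; OUR BOOKKEEPING.  **THE `m = 0` BASE VALUE**: for `a ≠ b` the crossed orbit sum `(a,b;a,b)` of the plain cell charge of member `0` at cell `N₀` is
`16·M²·cE₂·c·N₀⁴` (at the pins with `N₀ = Lc`: `2·Lc¹²`; cf. `crossed_faceRead_memberZero`'s `2·Lc⁸·P⁶` at `P = Lc`: the face read of member `0` is `Lc²` times its cell charge). -/
theorem crossed_zmode_memberZero (N₀ : ℕ) (cE cVH cΛ cE₂ cB c : ℝ) (M : ℕ) (ρ : Fin (3 + 1) → ℤ) {vh₂S mixFF : Tab 3}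
    (hBff : ∀ κ u κ' u' x z (α β : Fin (3 + 1)), vh₂S κ u κ' u' x z (Sum.inl α) (Sum.inl β) = 0) {a b : Fin (3 + 1)} (hab : a ≠ b) :
    zmode N₀ (unitS₂ (sfStep Lc 0) (smStep 3 Lc 0) (T2RecAt 3 Lc ρ cE cVH cΛ cE₂ cB (c • wsym22 M) vh₂S mixFF 0)) a b (Sum.inl a) (Sum.inl b)
      + zmode N₀ (unitS₂ (sfStep Lc 0) (smStep 3 Lc 0) (T2RecAt 3 Lc ρ cE cVH cΛ cE₂ cB (c • wsym22 M) vh₂S mixFF 0)) b a (Sum.inl a) (Sum.inl b)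
      + (zmode N₀ (unitS₂ (sfStep Lc 0) (smStep 3 Lc 0) (T2RecAt 3 Lc ρ cE cVH cΛ cE₂ cB (c • wsym22 M) vh₂S mixFF 0)) a b (Sum.inl b) (Sum.inl a)
      + zmode N₀ (unitS₂ (sfStep Lc 0) (smStep 3 Lc 0) (T2RecAt 3 Lc ρ cE cVH cΛ cE₂ cB (c • wsym22 M) vh₂S mixFF 0)) b a (Sum.inl b) (Sum.inl a))
      = 16 * (M : ℝ) ^ 2 * cE₂ * c * (N₀ : ℝ) ^ 4 := by
  have hba : b ≠ a := fun h => hab h.symm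
  rw [zmode_memberZero_wsym22 (d := 3) N₀ cE cVH cΛ cE₂ cB c M ρ hBff a b a b, zmode_memberZero_wsym22 (d := 3) N₀ cE cVH cΛ cE₂ cB c M ρ hBff b a a b,
    zmode_memberZero_wsym22 (d := 3) N₀ cE cVH cΛ cE₂ cB c M ρ hBff a b b a, zmode_memberZero_wsym22 (d := 3) N₀ cE cVH cΛ cE₂ cB c M ρ hBff b a b a]
  simp only [hab, hba, and_self, if_true, if_false]
  ring

end MemberZero

end Summit.QuantumFields.BalabanUV.Beta.GAN24.PairFormPeriodTowerBase
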